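import Mathlib
import HarnessLib
import Summits.HubbardSuperconductivity.HubbardSuperconductivity.Theorems.KLProgrammeKLRegimeEnginePairTransferGridSmearing
import Summits.HubbardSuperconductivity.HubbardSuperconductivity.Theorems.KLProgrammeKLRegimeEnginePairTransferDLineSupport

/-!
# Route `KLProgramme` — ENGINE child gen 8 (stmt-HubbardSuperconductivity-20437 `KLRegimeEngineV17F2`), skeleton v2 class #5 rev 3: the `γ` row of the GRID-currency producer DISCHARGED —
# `klmg_hubbardCutoffWeightCT_anti`, `klmg_runningSymbol_abs_le` (running scale: k3c2-p2's `scaleAt_mem`), **`klmg_isGramBoundedR_gridSub_runningSymbol`** (`γ = √6047`, β-uniform, every running symbol of the family)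
# (cell gate-hubbard-kl, seat hubbard-kl-k3c1-p1 g14, technique «composed-map remainder propagation»; composes k3c4-p1's `infraredGram_frame_le` with row 45's mass-Gram lemma)

WHY.  Row 48 (`pairTransferStep7_of_analytic_grid`) asks, per pair and `t ∈ [0,1]`, for ONE Gram constant `γ` of the grid pullbacks `Sᵀ·softCovOf K Φᵢ(t)·S` of both members' running-symbol
covariances, `Φᵢ(t) = s_{n+1,i} + (w^K_{Λ_{n+1}} − w^K_{Λ(t)}) = w^K_{Λ_i} − w^K_{Λ(t)}` (`n + 1 ≤ i`, `Λ(t) = Λₙ + t(Λ_{n+1} − Λₙ)`).  By row 45 (`klmg_isGramBoundedR_gridSub_softCovOf_of_mass_le`) `γ²` is the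
MASS `(βL²)⁻¹Σ_k |Φᵢ(t)(k)|/ρ_K(k)`; since the cutoff weight is antitone in the cutoff, `0 ≤ Φᵢ(t) ≤ 1 − w^K_{Λ(t)} ≤ 1 − w^K_{Λ*}`, `Λ* = max(Λ(t), π/β) ∈ [π/β, e₀]`, and k3c4-p1's
`infraredGram_frame_le` (`Σ (1 − w^K_Λ)/ρ_K ≤ (7·1793·Λ + (Λ+8)·704)·βL²` for `π/β ≤ Λ ≤ 3/80`, admissible frame, `β ≤ L`) gives `γ² ≤ 7·1793·e₀ + (e₀ + 8)·704 ≤ 6047` — the SAME constant as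
k3c2-p1 g5's scale-0 `isGramBoundedR_gridSub_softSubCov_zero`, now at every scale, every frame `K` with `FrameOK`, every `t ∈ [0,1]`, every grid.  So the `γ` rows of row 48 are discharged by
`γ := √6047` (its `0 ≤ γ` row by `Real.sqrt_nonneg`).  Nothing about the model's sizes beyond this is asserted; nothing asserts (X).3, (c), K3 or superconductivity.  0 kit · 0 lit.
-/

noncomputable section

namespace Summit.HubbardSuperconductivity.HubbardSuperconductivity.Theorems.KLRegimeSplit

set_option linter.dupNamespace false -- summit = problem name (single-conjunct summit), D-0017

open Finset Matrix Set Literature.MathematicalPhysics.QuantumLattice Literature.Probability.LatticeModels GrassmannAlgebra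
open Summit.HubbardSuperconductivity.HubbardSuperconductivity.Theorems.KLProgrammeLegKernels
open Summit.HubbardSuperconductivity.HubbardSuperconductivity.Theorems.DispersionFlow
open Summit.HubbardSuperconductivity.HubbardSuperconductivity.Theorems.KLRegimeWick
open Summit.HubbardSuperconductivity.HubbardSuperconductivity.Theorems.EngineV8

variable (L M : ℕ) [NeZero L]

omit [NeZero L] in
/-- The cutoff weight is ANTITONE in the (real, positive) cutoff: `0 < Λ₁ ≤ Λ₂ ⇒ w^K_{Λ₂}(k) ≤ w^K_{Λ₁}(k)` (`salmhoferCutoff` is monotone in `ρ²/Λ²`). -/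
theorem klmg_hubbardCutoffWeightCT_anti (β μ : ℝ) (K : TrigPolyC4v) {Λ₁ Λ₂ : ℝ} (h₁ : 0 < Λ₁) (h₁₂ : Λ₁ ≤ Λ₂) (k : FreqMomentum L M) :
    hubbardCutoffWeightCT L M β μ K Λ₂ k ≤ hubbardCutoffWeightCT L M β μ K Λ₁ k := by
  unfold hubbardCutoffWeightCT
  refine monotone_salmhoferCutoff ?_
  have hE : 0 ≤ matsubaraFreq β M k.1 ^ 2 + nambuXiCT L μ K k.2 ^ 2 := by positivity
  exact div_le_div_of_nonneg_left hE (by positivity) (pow_le_pow_left₀ h₁.le h₁₂ 2)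

omit [NeZero L] in
/-- **The running symbol is a soft symbol below the running cutoff**: for `n + 1 ≤ i` and `t ∈ [0,1]`,
`|s_{n+1,i}(k) + (w^K_{Λ_{n+1}}(k) − w^K_{Λ(t)}(k))| ≤ 1 − w^K_{Λ(t)}(k)`. -/
theorem klmg_runningSymbol_abs_le (β μ : ℝ) (K : TrigPolyC4v) (n i : ℕ) (hi : n + 1 ≤ i) {t : ℝ} (ht : t ∈ Icc (0 : ℝ) 1) (k : FreqMomentum L M) :
    |softSymbolCompl L M β μ K (n + 1) i k + (hubbardCutoffWeightCT L M β μ K (klScale klE0 (n + 1)) k -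
        hubbardCutoffWeightCT L M β μ K (klScale klE0 n + t * (klScale klE0 (n + 1) - klScale klE0 n)) k)| ≤
      1 - hubbardCutoffWeightCT L M β μ K (klScale klE0 n + t * (klScale klE0 (n + 1) - klScale klE0 n)) k := by
  obtain ⟨hlo, -⟩ := scaleAt_mem n ht
  -- `Λ_i ≤ Λ_{n+1} ≤ Λ(t)` so `w_{Λ(t)} ≤ w_{Λ_{n+1}} ≤ w_{Λ_i} ≤ 1`
  have hwi : hubbardCutoffWeightCT L M β μ K (klScale klE0 (n + 1)) k ≤ hubbardCutoffWeightCT L M β μ K (klScale klE0 i) k :=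
    hubbardCutoffWeightCT_klScale_mono (L := L) β μ K hi k
  have hwt : hubbardCutoffWeightCT L M β μ K (klScale klE0 n + t * (klScale klE0 (n + 1) - klScale klE0 n)) k ≤
      hubbardCutoffWeightCT L M β μ K (klScale klE0 (n + 1)) k :=
    klmg_hubbardCutoffWeightCT_anti L M β μ K (klth_klScale_pos (n + 1)) hlo k
  have h1 : hubbardCutoffWeightCT L M β μ K (klScale klE0 i) k ≤ 1 := (salmhoferCutoff_mem_Icc _).2
  unfold softSymbolCompl
  rw [abs_le]
  constructor <;> linarith

/-- **`klmg_isGramBoundedR_gridSub_runningSymbol`** — the `γ` row of row 48 DISCHARGED: for an admissible frame `K` (`FrameOK R U N μ K`), `klBetaMin ≤ β ≤ L`, `n + 1 ≤ i`, `t ∈ [0,1]`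
and ANY grid `Ng`, with `Φ` the running-symbol pin of `klmd_pinnedDefect_eq_resolved` / row 48 (`Φ = fun t k => s_{n+1,i}(k) + (w^K_{Λ_{n+1}}(k) − w^K_{Λ(t)}(k))`):
`IsGramBoundedR (Sᵀ·softCovOf K (Φ t)·S) √6047`, `S = hubbardGridSub L M β Ng`. -/
theorem klmg_isGramBoundedR_gridSub_runningSymbol {R : RenConsts} {U : ℝ} {Nsc : ℕ} {μ : ℝ} {K : TrigPolyC4v} (hK : FrameOK R U Nsc μ K)
    {β : ℝ} (hβ : klBetaMin ≤ β) (hβL : β ≤ L) (n i : ℕ) (hi : n + 1 ≤ i)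
    (Φ : ℝ → FreqMomentum L M → ℝ) (hΦ : Φ = fun t k => softSymbolCompl L M β μ K (n + 1) i k + (hubbardCutoffWeightCT L M β μ K (klScale klE0 (n + 1)) k -
        hubbardCutoffWeightCT L M β μ K (klScale klE0 n + t * (klScale klE0 (n + 1) - klScale klE0 n)) k))
    {t : ℝ} (ht : t ∈ Icc (0 : ℝ) 1) (Ng : ℕ) :
    IsGramBoundedR ((hubbardGridSub L M β Ng).transpose * softCovOf L M β μ K (Φ t) * hubbardGridSub L M β Ng) (Real.sqrt 6047) := by
  have hβ0 : 0 < β := pos_of_klBetaMin_le hβ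
  have hL : (0 : ℝ) < L := by exact_mod_cast Nat.pos_of_ne_zero (NeZero.ne L)
  have hβL2 : 0 < β * (L : ℝ) ^ 2 := by positivity
  set Λt : ℝ := klScale klE0 n + t * (klScale klE0 (n + 1) - klScale klE0 n) with hΛt
  set Λs : ℝ := max Λt (Real.pi / β) with hΛs
  obtain ⟨hlo, hhi⟩ := scaleAt_mem n ht
  have hΛt0 : 0 < Λt := lt_of_lt_of_le (klth_klScale_pos (n + 1)) hlo
  have he₀' : klE0 ≤ 3 / 80 := by norm_num [klE0]
  have hn0 : klScale klE0 n ≤ klE0 := by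
    unfold klScale
    have hE0 : (0 : ℝ) ≤ klE0 := by norm_num [klE0]
    have h4 : (1 : ℝ) ≤ (4 : ℝ) ^ n := one_le_pow₀ (by norm_num)
    calc klE0 * ((4 : ℝ) ^ n)⁻¹ ≤ klE0 * 1 := mul_le_mul_of_nonneg_left (inv_le_one_of_one_le₀ h4) hE0
      _ = klE0 := mul_one _
  have hπβ : Real.pi / β ≤ klE0 := by
    rw [div_le_iff₀ hβ0, klE0]
    have h128 : (128 : ℝ) ≤ β := by simpa [klBetaMin] using hβ
    nlinarith [Real.pi_lt_four]
  have hΛs_le : Λs ≤ klE0 := max_le (hhi.trans hn0) hπβ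
  have hΛs_pos : 0 < Λs := lt_of_lt_of_le hΛt0 (le_max_left _ _)
  -- the infrared sum of the frame at `Λ*`
  have hsum := infraredGram_frame_le (L := L) (M := M) hK hβ0 hΛs_pos (le_max_right _ _) (hΛs_le.trans he₀') hβL
  refine klmg_isGramBoundedR_gridSub_softCovOf_of_mass_le L M hβ0 μ K Ng (Φ t) (Real.sqrt_nonneg _) ?_
  rw [Real.sq_sqrt (by norm_num)]
  -- termwise `|Φ t k| ≤ 1 − w_{Λ(t)}(k) ≤ 1 − w_{Λ*}(k)`
  have hterm : ∀ k : FreqMomentum L M, |Φ t k| / Real.sqrt (matsubaraFreq β M k.1 ^ 2 + nambuXiCT L μ K k.2 ^ 2) ≤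
      (1 - hubbardCutoffWeightCT L M β μ K Λs k) / Real.sqrt (matsubaraFreq β M k.1 ^ 2 + nambuXiCT L μ K k.2 ^ 2) := by
    intro k
    refine div_le_div_of_nonneg_right ?_ (Real.sqrt_nonneg _)
    have h1 := klmg_runningSymbol_abs_le L M β μ K n i hi ht k
    have h2 : hubbardCutoffWeightCT L M β μ K Λs k ≤ hubbardCutoffWeightCT L M β μ K Λt k :=
      klmg_hubbardCutoffWeightCT_anti L M β μ K hΛt0 (le_max_left _ _) k
    rw [hΦ]
    dsimp only
    linarith
  calc 1 / (β * (L : ℝ) ^ 2) * ∑ k : FreqMomentum L M, |Φ t k| / Real.sqrt (matsubaraFreq β M k.1 ^ 2 + nambuXiCT L μ K k.2 ^ 2)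
      ≤ 1 / (β * (L : ℝ) ^ 2) * ∑ k : FreqMomentum L M, (1 - hubbardCutoffWeightCT L M β μ K Λs k) / Real.sqrt (matsubaraFreq β M k.1 ^ 2 + nambuXiCT L μ K k.2 ^ 2) :=
        mul_le_mul_of_nonneg_left (sum_le_sum fun k _ => hterm k) (by positivity)
    _ ≤ 1 / (β * (L : ℝ) ^ 2) * ((7 * 1793 * Λs + (Λs + 8) * 704) * β * (L : ℝ) ^ 2) := mul_le_mul_of_nonneg_left hsum (by positivity)
    _ = 7 * 1793 * Λs + (Λs + 8) * 704 := by field_simp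
    _ ≤ 6047 := by rw [klE0] at hΛs_le; nlinarith

end Summit.HubbardSuperconductivity.HubbardSuperconductivity.Theorems.KLRegimeSplit

end
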